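import Mathlib
import Literature.AlgebraicGeometry.Tropical.InitialIdeal

/-!
# TropicalLinks / InductiveStep — a monomial initial form empties the degeneration

Route `ResolutionOfSingularities/TropicalLinks`, crux `InductiveStep` (stmt-ResolutionOfSingularities-17233),
line `split`, in support of stub `stub_sncClosureSchon`.

The fundamental criterion of tropical geometry (Maclagan–Sturmfels §2.6: `w ∉ Trop V(J)` iff `in_w(J)`
contains a monomial), in the route's inlined terms for the unit-graph re-embedding
`I' = ⟨ι(I), y_j − ι(G_j)⟩ ⊆ k[ℤ^(N+m)]`: if SOME element `f ∈ I'` has an initial form `in_w(f)` with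
exactly one term (stated for an arbitrary self-map `inw` in place of `in_w`, which sidesteps the
decidability-instance trap of the inlined `Finsupp.filter`), then that term is a Laurent monomial with nonzero coefficient, hence a unit, so
`in_w(I') = ⊤` and the schön clause of `SchonAt` at `w` holds vacuously. Together with
`TropicalLinksInductiveStepOffTropical.lean` (the case `f = y_j − ι(G_j)` with `y_j` strictly lightest)
this reduces the schön clause to the weights at which, for every generator one cares to test, the
minimal weight is attained at least twice — the tropical variety of `U[G⁻¹]`.
-/

-- single-problem summit: the doubled namespace component `ResolutionOfSingularities` is forced
set_option linter.dupNamespace false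

namespace Summit.ResolutionOfSingularities.ResolutionOfSingularities.Theorems

open AddMonoidAlgebra

/-- **A one-term Laurent polynomial over a field is a unit.** If the coefficient function of
`F ∈ k[M]` (`M` an additive commutative group, `k` a field) has exactly one point in its support,
then `F` is a monomial with nonzero coefficient, hence a unit. [folklore] -/
theorem tropicalLinks_isUnit_of_card_support_eq_one {k : Type} [Field k] {M : Type} [AddCommGroup M]
    (F : AddMonoidAlgebra k M) (h : F.coeff.support.card = 1) : IsUnit F := by
  obtain ⟨v, hv⟩ := Finset.card_eq_one.1 h
  have hc : F.coeff v ≠ 0 := by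
    rw [← Finsupp.mem_support_iff, hv]
    exact Finset.mem_singleton_self v
  have hF : F = single v (F.coeff v) := by
    rw [← ofCoeff_single, ← (Finsupp.eq_single_iff.2 ⟨hv.le, rfl⟩), ofCoeff_coeff]
  rw [hF]
  exact Literature.AlgebraicGeometry.Tropical.isUnit_single (Ne.isUnit hc) v

/-- **A one-term element in the generating image empties the quotient** (the route's inlined
extended ideal, any "initial form" map). For the extended ideal `I' = ⟨ι(I), y_j − ι(G_j)⟩ ⊆ k[ℤ^(N+m)]`
and ANY self-map `inw` of `k[ℤ^(N+m)]` (intended: the route's initial-form map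
`f ↦ ofCoeff (f.coeff.filter (w-minimal exponents))` at a weight `w`): if some `f ∈ I'` has `inw f`
with exactly one term, then `inw f` is a unit, `Ideal.span (inw '' I') = ⊤`, and every "localization at
a prime of the quotient is regular" statement holds vacuously (the quotient is the zero ring). With
`inw = in_w` this is the monomial criterion `w ∉ Trop ⇒` empty degeneration.
[cite: MaclaganSturmfels2015, §2.6] -/
theorem tropicalLinks_schonClause_of_card_support_eq_one :
    ∀ (k : Type) [Field k] (N m : ℕ) (I : Ideal (AddMonoidAlgebra k (Fin N → ℤ))) (G : Fin m → AddMonoidAlgebra k (Fin N → ℤ)) (inw : AddMonoidAlgebra k (Fin (N + m) → ℤ) → AddMonoidAlgebra k (Fin (N + m) → ℤ)) (f : AddMonoidAlgebra k (Fin (N + m) → ℤ)), f ∈ Ideal.span ((fun f : AddMonoidAlgebra k (Fin N → ℤ) => (AddMonoidAlgebra.ofCoeff (f.coeff.mapDomain fun v => Fin.append v (0 : Fin m → ℤ)) : AddMonoidAlgebra k (Fin (N + m) → ℤ))) '' (↑I : Set (AddMonoidAlgebra k (Fin N → ℤ))) ∪ Set.range (fun j : Fin m => AddMonoidAlgebra.single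 (Fin.append (0 : Fin N → ℤ) (Pi.single j (1 : ℤ))) (1 : k) - AddMonoidAlgebra.ofCoeff ((G j).coeff.mapDomain fun v => Fin.append v (0 : Fin m → ℤ)))) → (inw f).coeff.support.card = 1 → ∀ (P : Ideal (AddMonoidAlgebra k (Fin (N + m) → ℤ) ⧸ Ideal.span (inw '' (↑(Ideal.span ((fun f : AddMonoidAlgebra k (Fin N → ℤ) => (AddMonoidAlgebra.ofCoeff (f.coeff.mapDomain fun v => Fin.append v (0 : Fin m → ℤ)) : AddMonoidAlgebra k (Fin (N + m) → ℤ))) '' (↑I : Set (AddMonoidAlgebra k (Fin N → ℤ))) ∪ Set.range (fun j : Fin m => AddMonoidAlgebra.single (Fin.append (0 : Fin N → ℤ) (Pi.single j (1 : ℤ))) (1 : k) - AddMonoidAlgebra.ofCoeff ((G j).coeff.mapDomain fun v => Fin.append v (0 : Fin m → ℤ))))) : Set (AddMonoidAlgebra k (Fin (N + m) → ℤ)))))) [P.IsPrime], IsRegularLocalRing (Localization.AtPrime P) := by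
  intro k _ N m I G inw f hf hcard P hP
  exfalso
  have htop := Ideal.eq_top_of_isUnit_mem _ (Ideal.subset_span (Set.mem_image_of_mem inw hf))
    (tropicalLinks_isUnit_of_card_support_eq_one _ hcard)
  haveI := Ideal.Quotient.subsingleton_iff.mpr htop
  exact hP.ne_top (Subsingleton.elim _ _)

end Summit.ResolutionOfSingularities.ResolutionOfSingularities.Theorems
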